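import Literature.MathematicalPhysics.QuantumFieldTheory.Balaban1983to89.Beta.WilsonWard22
import Literature.MathematicalPhysics.QuantumFieldTheory.Balaban1983to89.Beta.PlaquetteVertex2
import Summits.QuantumFields.BalabanUV.Beta.WilsonBiStencilWardEntry
import Summits.QuantumFields.BalabanUV.Beta.WilsonJetReflection2Polar

/-!
# `BalabanUV.Beta.WilsonFluctuationWard22Letters` — the five jet groups of the fluctuation-gauge Ward identity (E₂) EVALUATED AT BOND
# LETTERS, in coordinates: letter-level lemmas (file (R2a) of the kernel route to the fluctuation-LEG pure-gauge law of the Wilson bi-stencil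
# `wilsonW₂ d ((8N²)⁻¹ • wsym22 N)` and to the torus row `torus_a2_wilson`; D1 formalisation swarm seat `b2b-balaban-beta-d1-formalise-leaf-05`, gen 35)

HONEST FRAMING (cell charter, verbatim): «discharging `BetaPertH` makes Bałaban's UV stability UNCONDITIONAL — a real
constructive-QFT result; it is NOT the continuum limit and NOT the Clay problem.»  HONEST DEPENDENCY (cell records, verbatim):
«continuum YM on T⁴ ⇐ BetaPertH ∧ nine spine estimates (0/9 proved); BetaPertH ⇐ (D1) ∧ (D4) ∧ CAP+tail; G-an2-4 gates asym, D1 and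
NE2/3/4.»  DERIVED cell leaf: [folklore] finite-dimensional algebra over an arbitrary finite abelian lattice, no estimate, no limit, nothing
cited — every statement is kernel-proved here; no `[cite:]` tag, no `def`, no `def … : Prop`.  By itself this file instantiates NO binder of
the β-function wall and NO row of the door.  NOT D1, NOT `BetaPertH`, NOT continuum, NOT Clay.  «not in print; our bookkeeping».
ABSOLUTE RULE (cell charter, verbatim): «No internally-minted statement may enter as a cited fact. Every hypothesis is either
kernel-proved in this package or a verbatim quotation of a PUBLISHED theorem with page reference. The manuscript(s) under audit are
NOT citable for their own disputed steps — they are the thing under adjudication; programme-internal (2001/route/tribunal) claims are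
never citable.»

## What

an3's (E₂) (`WilsonWard22.ward22`; summed over a finite lattice in this lineage's `WilsonFluctuationWard22.jet22_flucWard`) reads
`4•PolW jet22(h, W₀λ; B) + 4•PolW jet21(h, W₁(B)λ; B) + 2•PolW jet20(h, 2W₂(B)λ) = 2•jet12(N₀(h)λ; B) + 2•jet11(N₁(h)λ; B)`.
The sequel (R2b) reads it at ONE-BOND LETTER FIELDS — `h = bondLetter x α X` (the fluctuation test leg with letter `X`), `λ = ℓ • X` (the gauge
parameter with THE SAME letter, so that the `N₀`-current `[h, λ₋ + λ₊]` vanishes identically), `B = bondLetter u κ Y₁ + bondLetter u′ κ′ Y₂` (two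
background bond letters, polarised) — and this file supplies the LETTER-LEVEL EVALUATION of each jet group, in the coordinate currency of an3
(`PlaquetteVertex.field`, `PlaquetteVertex2Stencil.hess22`, `WilsonVertex2Kron.wilsonVertex₂`, `PlaquetteBackground.wilsonVertexOp`,
`PlaquetteStencil.wilsonVertex₁`, `PlaquetteVertex.lcurl`) and of leaf-05-g2 ∕ leaf-09 (`WilsonStencilDivergence.curlCurl`, `WilsonReflectionFrame.Lc`∕`S₀A`,
`WilsonBiStencilWardFrame.jet21_polar_field`, `WilsonBiStencilWardEntry.wilsonVertexOp_bondLetter`):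
* §1 the `(1,1)`-current IS the kinetic pairing: `jet11 τ e W B = Σ_x Σ_μν τ(lcurl W · lcurl B)` (an3's `P11_eq`: `P11 = Z_W·Z_B + twist`, and a
  tracial `τ` kills the twist, a sum of commutators — `trace_twistAux`); additivity of `jet11` in both slots; `jet12` of the zero fluctuation.
* §2 letters: `lcurl` of a bond letter is the scalar curl times the letter; **the kinetic pairing of two bond letters**
  `Σ τ(lcurl (bondLetter p X) · lcurl (bondLetter q Z)) = (2·Lc e q.2 q.1 p)·τ(X·Z)` (leaf-05-g2's `curlCurl_eq_two_mul_Lc`); pointwise products;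
  `gaugeDir₀`∕`gaugeDir₁` of bond letters against `λ = ℓ • X`; the vanishing `currArg₀ e (bondLetter x α X) (ℓ • X) = 0`.
* §3 coordinates: `field T δ_{(z,(c,γ))} = bondLetter z γ (T c)`, `field T (r • δ) = bondLetter z γ (r • T c)`, the pure gauge `gaugeDir₀ e (ℓ • T c)` as the
  coordinate field of the profile differences at colour `c`.
* §4 **`jet21_polar_bondLetters`**: `PolW jet21(bondLetter p X, bondLetter q K; bondLetter b Y) = −2·τ(Y·(X·K − K·X))·S₀A e b.1 b.2 p q` (any letters
  `X K Y`; leaf-09's `jet21_polar_field` in the family `![X, K]`, `wilsonVertexOp_bondLetter`, an3's `wilsonVertex₁_apply_eq_mul`; the two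
  `(2,1)` entries antisymmetrise to an3's colourless `S₀A`).
* §5 **`jet22_polar₂_field`**: the `W`-polarisation of the `(2,2)`-jet between two coordinate fields at a background, polarised again in two coordinate
  backgrounds, is the symmetrised cross two-bond vertex: `V ⬝ᵥ ((X + Xᵀ) U)`, `X = ΣΣ (u p₁ · u′ p₂) • (wilsonVertex₂ T p₁ p₂ + wilsonVertex₂ T p₂ p₁)`
  (an3's `jet22_field_quadForm`, `hess22_polar`, `dotProduct_mulVec_polar`).
NOT HERE: the assembled entry law with colour ((R2b)), the fluctuation-colour trace ((R2c)), `ℤ^{d+1}`, the torus.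
Provenance: pub-balaban β sub-cell, D1 formalisation swarm, unit `b2b-balaban-beta-d1-formalise-leaf-05` gen 35, 2026-08-23 (v1); over the files
named above BY NAME; no existing file touched.
-/

namespace Summit.QuantumFields.BalabanUV.Beta.WilsonFluctuationWard22Letters

open Finset
open scoped BigOperators Matrix
open Literature.MathematicalPhysics.QuantumFieldTheory.Balaban1983to89.Beta
open Literature.MathematicalPhysics.QuantumFieldTheory.Balaban1983to89.Beta.TransportVertices
open Literature.MathematicalPhysics.QuantumFieldTheory.Balaban1983to89.Beta.WilsonVertex
open Literature.MathematicalPhysics.QuantumFieldTheory.Balaban1983to89.Beta.WilsonVertex2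
open Literature.MathematicalPhysics.QuantumFieldTheory.Balaban1983to89.Beta.SpinTable (br)
open Literature.MathematicalPhysics.QuantumFieldTheory.Balaban1983to89.Beta.PlaquetteVertex (field adM adM_apply bondLetter lcurl lcurl_add
  plaqWord jet21 jet20 sum_wpart_plaqWord sum_bpart_plaqWord)
open Literature.MathematicalPhysics.QuantumFieldTheory.Balaban1983to89.Beta.PlaquetteVertex2 (jet22)
open Literature.MathematicalPhysics.QuantumFieldTheory.Balaban1983to89.Beta.PlaquetteStencil (wilsonVertex₁)
open Literature.MathematicalPhysics.QuantumFieldTheory.Balaban1983to89.Beta.PlaquetteVertex2Stencil (hess22 jet22_field_quadForm)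
open Literature.MathematicalPhysics.QuantumFieldTheory.Balaban1983to89.Beta.PlaquetteBackground (wilsonVertexOp)
open Literature.MathematicalPhysics.QuantumFieldTheory.Balaban1983to89.Beta.WilsonWardJets (gaugeDir₀ gaugeDir₁ currArg₀ jet11)
open Literature.MathematicalPhysics.QuantumFieldTheory.Balaban1983to89.Beta.WilsonWardJets2 (jet12)
open Literature.MathematicalPhysics.QuantumFieldTheory.Balaban1983to89.Beta.WilsonWard22 (P12_plaq_zero)
open Literature.MathematicalPhysics.QuantumFieldTheory.Balaban1983to89.Beta.WilsonVertexKron (wilsonStencil₀ wilsonVertex₁_apply_eq_mul)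
open Literature.MathematicalPhysics.QuantumFieldTheory.Balaban1983to89.Beta.WilsonVertex2Kron (wilsonVertex₂ hess22_field_eq_sum_wilsonVertex₂)
open Literature.MathematicalPhysics.QuantumFieldTheory.Balaban1983to89.Beta.WilsonVertex2Sym (hess22_polar jet22_polar_left)
open Summit.QuantumFields.BalabanUV.Beta.WilsonReflectionFrame (Lc S₀A)
open Summit.QuantumFields.BalabanUV.Beta.WilsonStencilDivergence (curlCurl curlCurl_eq_two_mul_Lc single_eq_bondLetter)
open Summit.QuantumFields.BalabanUV.Beta.WilsonJetReflection2Polar (jet20_polar)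
open Summit.QuantumFields.BalabanUV.Beta.WilsonBiStencilWardFrame (jet21_polar_field field_add)
open Summit.QuantumFields.BalabanUV.Beta.WilsonBiStencilWardEntry (wilsonVertexOp_bondLetter)

/-! ## §1 The `(1,1)`-current is the kinetic pairing of the two curls -/

section Current

variable (𝕜 : Type*) [RCLike 𝕜] {𝔸 : Type*} [NormedRing 𝔸] [NormedAlgebra 𝕜 𝔸]
variable {V : Type*} [AddCommGroup V] [Module 𝕜 V]

/-- [folklore] a tracial functional kills the twist sum (a sum of commutators), for every accumulator. -/
theorem trace_twistAux (τ : 𝔸 →ₗ[𝕜] V) (hτ : ∀ a b : 𝔸, τ (a * b) = τ (b * a)) (β : 𝔸) (L : List (Bool × 𝔸)) :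
    τ (twistAux β L) = 0 := by
  induction L generalizing β with
  | nil => simp
  | cons p L ih =>
    obtain ⟨t, z⟩ := p
    cases t
    · rw [twistAux_consB, ih]
    · rw [twistAux_consW, map_add, ih, map_sub, hτ, sub_self, zero_add]

/-- [folklore] the `(1,1)`-component under a tracial functional: `τ(P11 L) = τ(Z_W · Z_B)` (an3's `P11_eq`; the twist is traceless). -/
theorem trace_P11 (τ : 𝔸 →ₗ[𝕜] V) (hτ : ∀ a b : 𝔸, τ (a * b) = τ (b * a)) (L : List (Bool × 𝔸)) :
    τ (P11 L) = τ ((wpart L).sum * (bpart L).sum) := by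
  rw [P11_eq, map_add, trace_twistAux 𝕜 τ hτ, add_zero]

variable {Λ : Type*} [Fintype Λ] [AddCommGroup Λ] {D : Type*} [Fintype D]

/-- [folklore] **THE `(1,1)`-CURRENT IS THE KINETIC PAIRING**: `jet11 τ e W B = Σ_x Σ_μ Σ_ν τ(lcurl W x μ ν · lcurl B x μ ν)` (tracial `τ`). -/
theorem jet11_eq_kin (τ : 𝔸 →ₗ[𝕜] V) (hτ : ∀ a b : 𝔸, τ (a * b) = τ (b * a)) (e : D → Λ) (W B : Λ → D → 𝔸) :
    jet11 𝕜 τ e W B = ∑ x, ∑ μ, ∑ ν, τ (lcurl e W x μ ν * lcurl e B x μ ν) := by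
  refine Finset.sum_congr rfl fun x _ => Finset.sum_congr rfl fun μ _ => Finset.sum_congr rfl fun ν _ => ?_
  rw [trace_P11 𝕜 τ hτ, sum_wpart_plaqWord, sum_bpart_plaqWord]

/-- [folklore] the current is additive in the fluctuation. -/
theorem jet11_add_left (τ : 𝔸 →ₗ[𝕜] V) (hτ : ∀ a b : 𝔸, τ (a * b) = τ (b * a)) (e : D → Λ) (W W' B : Λ → D → 𝔸) :
    jet11 𝕜 τ e (W + W') B = jet11 𝕜 τ e W B + jet11 𝕜 τ e W' B := by
  simp only [jet11_eq_kin 𝕜 τ hτ, lcurl_add, add_mul, map_add, Finset.sum_add_distrib]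

/-- [folklore] the current is additive in the background. -/
theorem jet11_add_right (τ : 𝔸 →ₗ[𝕜] V) (hτ : ∀ a b : 𝔸, τ (a * b) = τ (b * a)) (e : D → Λ) (W B B' : Λ → D → 𝔸) :
    jet11 𝕜 τ e W (B + B') = jet11 𝕜 τ e W B + jet11 𝕜 τ e W B' := by
  simp only [jet11_eq_kin 𝕜 τ hτ, lcurl_add, mul_add, map_add, Finset.sum_add_distrib]

/-- [folklore] the `(1,2)`-current of the zero fluctuation vanishes (`WilsonWard22.P12_plaq_zero`). -/
theorem jet12_zero_left (τ : 𝔸 →ₗ[𝕜] V) (e : D → Λ) (B : Λ → D → 𝔸) : jet12 𝕜 τ e 0 B = 0 := by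
  refine Finset.sum_eq_zero fun x _ => Finset.sum_eq_zero fun μ _ => Finset.sum_eq_zero fun ν _ => ?_
  simp only [plaqWord, Pi.zero_apply, P12_plaq_zero, map_zero]

end Current

/-! ## §2 Bond letters: curls, the kinetic pairing of two bond letters, products, the chart's letter fields -/

section Letters

variable {𝔸 : Type*} [NormedRing 𝔸] [NormedAlgebra ℝ 𝔸]
variable {Λ : Type*} [DecidableEq Λ] [AddCommGroup Λ] {D : Type*} [DecidableEq D]

omit [AddCommGroup Λ] in
/-- [folklore] a bond letter is the scalar bond indicator times the letter. -/
theorem bondLetter_eq_smul (z : Λ) (γ : D) (X : 𝔸) (x : Λ) (δ : D) :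
    bondLetter z γ X x δ = bondLetter z γ (1 : ℝ) x δ • X := by
  unfold bondLetter
  split_ifs <;> simp

/-- [folklore] the curl of a bond letter is the scalar curl of the bond indicator times the letter. -/
theorem lcurl_bondLetter (e : D → Λ) (z : Λ) (γ : D) (X : 𝔸) (x : Λ) (μ ν : D) :
    lcurl e (bondLetter z γ X) x μ ν = lcurl e (bondLetter z γ (1 : ℝ)) x μ ν • X := by
  simp only [lcurl, bondLetter_eq_smul z γ X, sub_smul]

omit [NormedAlgebra ℝ 𝔸] [AddCommGroup Λ] in
/-- [folklore] the pointwise product of two bond letters lives on the common bond. -/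
theorem bondLetter_mul_bondLetter (z : Λ) (γ : D) (X : 𝔸) (z' : Λ) (γ' : D) (X' : 𝔸) (x : Λ) (δ : D) :
    bondLetter z γ X x δ * bondLetter z' γ' X' x δ = bondLetter z γ (if z = z' ∧ γ = γ' then X * X' else 0) x δ := by
  unfold bondLetter
  by_cases h : x = z ∧ δ = γ
  · obtain ⟨rfl, rfl⟩ := h
    by_cases h' : x = z' ∧ δ = γ'
    · obtain ⟨rfl, rfl⟩ := h'
      simp
    · simp [h']
  · rw [if_neg h, zero_mul, if_neg h]

/-- [folklore] **THE ORDER-`B¹` GAUGE DIRECTION OF A BOND LETTER** against `λ = ℓ • X`: `W₁(bondLetter u κ Y)(ℓ • X) = bondLetter u κ (ℓ(u + e_κ) • (X·Y − Y·X))`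
(the letter `−[Y, X]` at the bond, weighted by the parameter at the bond's TIP). -/
theorem gaugeDir₁_bondLetter_smul (e : D → Λ) (u : Λ) (κ : D) (Y X : 𝔸) (ell : Λ → ℝ) :
    gaugeDir₁ e (bondLetter u κ Y) (fun y => ell y • X) = bondLetter u κ (ell (u + e κ) • (X * Y - Y * X)) := by
  funext x δ
  unfold gaugeDir₁ bondLetter
  by_cases h : x = u ∧ δ = κ
  · obtain ⟨rfl, rfl⟩ := h
    simp only [and_self, if_true, smul_mul_assoc, mul_smul_comm, smul_sub]
  · simp only [if_neg h, mul_zero, zero_mul, sub_self]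

omit [DecidableEq Λ] [DecidableEq D] in
/-- [folklore] the order-`B⁰` gauge direction of `λ = ℓ • X` is the profile-difference field times the letter. -/
theorem gaugeDir₀_smul (e : D → Λ) (ell : Λ → ℝ) (X : 𝔸) :
    gaugeDir₀ e (fun y => ell y • X) = fun x μ => (ell x - ell (x + e μ)) • X := by
  funext x μ
  rw [gaugeDir₀, sub_smul]

/-- [folklore] **THE `N₀`-CURRENT ARGUMENT VANISHES WHEN THE FLUCTUATION LETTER IS THE GAUGE LETTER**: `[h, λ₋ + λ₊] = 0` for `h = bondLetter x α X`,
`λ = ℓ • X`. -/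
theorem currArg₀_bondLetter_smul_self (e : D → Λ) (x : Λ) (α : D) (X : 𝔸) (ell : Λ → ℝ) :
    currArg₀ e (bondLetter x α X) (fun y => ell y • X) = 0 := by
  funext z δ
  unfold currArg₀ bondLetter
  by_cases h : z = x ∧ δ = α
  · obtain ⟨rfl, rfl⟩ := h
    simp only [and_self, if_true, ← add_smul, mul_smul_comm, smul_mul_assoc, sub_self, Pi.zero_apply]
  · simp only [if_neg h, zero_mul, mul_zero, sub_self, Pi.zero_apply]

variable [Fintype Λ] [Fintype D]

/-- [folklore] **THE KINETIC PAIRING OF TWO BOND LETTERS** (leaf-05-g2's `curlCurl_eq_two_mul_Lc`: the curl–curl matrix is twice an3's contact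
coefficient): `Σ_x Σ_μ Σ_ν τ(lcurl (bondLetter p.1 p.2 X) · lcurl (bondLetter q.1 q.2 Z)) = (2·Lc e q.2 q.1 p)·τ(X·Z)`. -/
theorem kin_bondLetter (τ : 𝔸 →ₗ[ℝ] ℝ) (e : D → Λ) (p q : Λ × D) (X Z : 𝔸) :
    ∑ x, ∑ μ, ∑ ν, τ (lcurl e (bondLetter p.1 p.2 X) x μ ν * lcurl e (bondLetter q.1 q.2 Z) x μ ν) = (2 * Lc e q.2 q.1 p) * τ (X * Z) := by
  rw [← curlCurl_eq_two_mul_Lc, curlCurl, single_eq_bondLetter, single_eq_bondLetter, Finset.sum_mul]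
  refine Finset.sum_congr rfl fun x _ => ?_
  rw [Finset.sum_mul]
  refine Finset.sum_congr rfl fun μ _ => ?_
  rw [Finset.sum_mul]
  refine Finset.sum_congr rfl fun ν _ => ?_
  rw [lcurl_bondLetter e p.1 p.2 X, lcurl_bondLetter e q.1 q.2 Z, smul_mul_smul_comm, map_smul, smul_eq_mul]

end Letters

/-! ## §3 Coordinates: deltas and profile differences of a letter family are bond letters and pure gauges -/

section Coordinates

variable {𝔸 : Type*} [NormedRing 𝔸] [NormedAlgebra ℝ 𝔸]
variable {Λ : Type*} [DecidableEq Λ] [AddCommGroup Λ] {C : Type*} [Fintype C] [DecidableEq C] {D : Type*} [DecidableEq D]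

omit [AddCommGroup Λ] in
/-- [folklore] the coordinate field of a scaled delta is the bond letter with the scaled family letter: `field T (r • δ_{(z,(c,γ))}) = bondLetter z γ (r • T c)`. -/
theorem field_smul_single (T : C → 𝔸) (r : ℝ) (z : Λ) (c : C) (γ : D) :
    field T (r • Pi.single (z, (c, γ)) (1 : ℝ)) = bondLetter z γ (r • T c) := by
  funext x k
  simp only [field, bondLetter, Pi.smul_apply, smul_eq_mul]
  by_cases h : x = z ∧ k = γ
  · obtain ⟨rfl, rfl⟩ := h
    rw [if_pos ⟨rfl, rfl⟩, Finset.sum_eq_single c]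
    · simp
    · intro c' _ hc
      rw [Pi.single_eq_of_ne (fun h' => hc (by simpa using h')), mul_zero, zero_smul]
    · intro h'; exact absurd (Finset.mem_univ _) h'
  · rw [if_neg h]
    refine Finset.sum_eq_zero fun c' _ => ?_
    rw [Pi.single_eq_of_ne, mul_zero, zero_smul]
    intro h'
    apply h
    simp only [Prod.mk.injEq] at h'
    exact ⟨h'.1, h'.2.2⟩

omit [AddCommGroup Λ] in
/-- [folklore] the coordinate field of a delta is the bond letter with the family letter: `field T δ_{(z,(c,γ))} = bondLetter z γ (T c)`. -/
theorem field_single (T : C → 𝔸) (z : Λ) (c : C) (γ : D) :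
    field T (Pi.single (z, (c, γ)) (1 : ℝ)) = bondLetter z γ (T c) := by
  have h := field_smul_single T 1 z c γ
  rwa [one_smul, one_smul] at h

omit [DecidableEq Λ] [DecidableEq D] in
/-- [folklore] the profile differences at ONE colour are the coordinates of the pure gauge `W₀(ℓ • T c)`:
`field T (Q ↦ [Q.colour = c]·(ℓ Q.site − ℓ (Q.site + e_{Q.dir}))) = gaugeDir₀ e (ℓ • T c)`. -/
theorem field_gaugeVec (T : C → 𝔸) (e : D → Λ) (ell : Λ → ℝ) (c : C) :
    field T (fun Q : Λ × (C × D) => if Q.2.1 = c then ell Q.1 - ell (Q.1 + e Q.2.2) else 0) = gaugeDir₀ e (fun y => ell y • T c) := by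
  funext x k
  simp only [field, gaugeDir₀]
  rw [Finset.sum_eq_single c]
  · simp [sub_smul]
  · intro c' _ hc; rw [if_neg hc, zero_smul]
  · intro h'; exact absurd (Finset.mem_univ _) h'

end Coordinates

/-! ## §4 The `(2,1)` group at bond letters: the two entries antisymmetrise to `S₀A` -/

section TwoOne

variable {𝔸 : Type*} [NormedRing 𝔸] [NormedAlgebra ℝ 𝔸]
variable {Λ : Type*} [Fintype Λ] [DecidableEq Λ] [AddCommGroup Λ] {D : Type*} [Fintype D] [DecidableEq D]

/-- [folklore] **THE `W`-POLARISED `(2,1)`-JET BETWEEN TWO BOND LETTERS AT A ONE-BOND BACKGROUND**: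
`jet21(bondLetter p X + bondLetter q K; bondLetter b Y) − jet21(bondLetter p X; …) − jet21(bondLetter q K; …) = −2·τ(Y·(X·K − K·X))·S₀A e b.1 b.2 p q`
— leaf-09's `jet21_polar_field` in the two-letter family `![X, K]`, the operator collapsed onto the bond (`wilsonVertexOp_bondLetter`), the two
entries evaluated by an3's `wilsonVertex₁_apply_eq_mul` (colour numbers `τ(Y·[X,K])`, `τ(Y·[K,X]) = −τ(Y·[X,K])`) and antisymmetrised into an3's
colourless `S₀A = ½(w − wᵀ)`. -/
theorem jet21_polar_bondLetters (τ : 𝔸 →ₗ[ℝ] ℝ) (hτ : ∀ a b : 𝔸, τ (a * b) = τ (b * a)) (e : D → Λ) (p q b : Λ × D) (X K Y : 𝔸) :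
    jet21 ℝ τ e (bondLetter p.1 p.2 X + bondLetter q.1 q.2 K) (bondLetter b.1 b.2 Y) - jet21 ℝ τ e (bondLetter p.1 p.2 X) (bondLetter b.1 b.2 Y)
        - jet21 ℝ τ e (bondLetter q.1 q.2 K) (bondLetter b.1 b.2 Y) =
      -(2 * τ (Y * (X * K - K * X)) * S₀A e b.1 b.2 p q) := by
  have hV : field ![X, K] (Pi.single (p.1, ((0 : Fin 2), p.2)) (1 : ℝ)) = bondLetter p.1 p.2 X := field_single _ _ _ _
  have hW : field ![X, K] (Pi.single (q.1, ((1 : Fin 2), q.2)) (1 : ℝ)) = bondLetter q.1 q.2 K := field_single _ _ _ _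
  have h := jet21_polar_field τ hτ ![X, K] e (Pi.single (p.1, ((0 : Fin 2), p.2)) (1 : ℝ)) (Pi.single (q.1, ((1 : Fin 2), q.2)) (1 : ℝ))
    (bondLetter b.1 b.2 Y)
  rw [field_add, hV, hW, wilsonVertexOp_bondLetter, Matrix.mulVec_single_one, Matrix.mulVec_single_one, single_dotProduct, single_dotProduct,
    one_mul, one_mul, Matrix.col_apply, Matrix.col_apply] at h
  rw [h]
  obtain ⟨px, pα⟩ := p
  obtain ⟨qx, qβ⟩ := q
  rw [wilsonVertex₁_apply_eq_mul, wilsonVertex₁_apply_eq_mul, adM_apply, adM_apply]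
  unfold S₀A
  simp only [Matrix.cons_val_zero, Matrix.cons_val_one, br]
  have hc : τ (Y * (K * X - X * K)) = -τ (Y * (X * K - K * X)) := by
    rw [← map_neg]; congr 1; noncomm_ring
  rw [hc]
  ring

end TwoOne

/-! ## §5 The `(2,2)` group in coordinates: double polarisation through the symmetrised cross two-bond vertex -/

section TwoTwo

variable {𝔸 : Type*} [NormedRing 𝔸] [NormedAlgebra ℝ 𝔸]
variable {Λ : Type*} [Fintype Λ] [DecidableEq Λ] [AddCommGroup Λ] {C : Type*} [Fintype C] {D : Type*} [Fintype D] [DecidableEq D]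

/-- [folklore] **THE DOUBLE POLARISATION OF THE `(2,2)`-JET** — in the fluctuation between two coordinate fields `V`, `U`, in the background between two
coordinate backgrounds `u`, `u′`: `Pol₂(u + u′) − Pol₂(u) − Pol₂(u′) = V ⬝ᵥ ((X + Xᵀ) U)` with
`X = Σ_{p₁} Σ_{p₂} (u p₁ · u′ p₂) • (wilsonVertex₂ T p₁ p₂ + wilsonVertex₂ T p₂ p₁)` (an3's `hess22_polar`). -/
theorem jet22_polar₂_field (τ : 𝔸 →ₗ[ℝ] ℝ) (hτ : ∀ a b : 𝔸, τ (a * b) = τ (b * a)) (T : C → 𝔸) (e : D → Λ) (V U u u' : Λ × (C × D) → ℝ) :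
    (jet22 ℝ τ e (field T (V + U)) (field T (u + u')) - jet22 ℝ τ e (field T V) (field T (u + u')) - jet22 ℝ τ e (field T U) (field T (u + u')))
      - (jet22 ℝ τ e (field T (V + U)) (field T u) - jet22 ℝ τ e (field T V) (field T u) - jet22 ℝ τ e (field T U) (field T u))
      - (jet22 ℝ τ e (field T (V + U)) (field T u') - jet22 ℝ τ e (field T V) (field T u') - jet22 ℝ τ e (field T U) (field T u')) =
      V ⬝ᵥ (((∑ p₁ : Λ × (C × D), ∑ p₂ : Λ × (C × D), (u p₁ * u' p₂) • (wilsonVertex₂ τ T e p₁ p₂ + wilsonVertex₂ τ T e p₂ p₁))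
        + (∑ p₁ : Λ × (C × D), ∑ p₂ : Λ × (C × D), (u p₁ * u' p₂) • (wilsonVertex₂ τ T e p₁ p₂ + wilsonVertex₂ τ T e p₂ p₁))ᵀ) *ᵥ U) := by
  rw [jet22_polar_left τ hτ, jet22_polar_left τ hτ, jet22_polar_left τ hτ, ← hess22_polar]
  rw [Matrix.transpose_sub, Matrix.transpose_sub]
  simp only [Matrix.add_mulVec, Matrix.sub_mulVec, dotProduct_add, dotProduct_sub]
  ring

end TwoTwo

end Summit.QuantumFields.BalabanUV.Beta.WilsonFluctuationWard22Letters
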